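import Literature.NumberTheory.ModularForms.ModularFormPeriodicTwist
import Summits.BirchSwinnertonDyer.BirchSwinnertonDyer.Theorems.PrintCFramBottomClassIndexLawFiveLeFlipRungTransport
import HarnessLib

set_option autoImplicit false

/-!
# Crux `PrintCFram.BottomClassIndexLawFiveLe` (stmt-BirchSwinnertonDyer-20372), line `eisenstein-resource-bdp-line` (registry v27,
# `stub_flipRung`): T4 file 3 — THE INPUT SOCKET: the twisted vehicle `V = q⁻² Σ_j h(j) F₀(· + j/q²)` IS a modular form on
# `Γ₁(L·q⁴)`, with its function exposed (T3's `hV` verbatim) and its q-expansion `ĥ(n)·c₀(n)`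
# (cell `bsd-print-cfram`, width seat `bsd-line-cfram-p1-w3` g19; THEOREMS ONLY, `--supports` 20372; BSD is not proved by any of this)

HONEST FRAMING. Nothing here is a statement about elliptic curves or BSD; no registered stub is closed. Katz's principle (NF-Q, consumed in
`…FlipRungTransport` §3 / `…FlipRungTransportReading` §7) wants the twisted vehicle as a `ModularForm (Gamma1 L') k` together with
«every coefficient of `qExpansion 1 V` lies in `p·ℤ̄[1/N]`»; seat w4 g19's T3 decomposition (`FlipRung.slash_flippedCusp_decomposition`,
p707746) wants it as a FUNCTION `V : ℍ → ℂ` with `hV : ∀ z, V z = ((q:ℂ)^2)⁻¹ * Σ_{j : ZMod (q^2)} h j * F₀ ((j.val/q²) +ᵥ z)`. The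
Literature theorem `PeriodicTwist.exists_modularForm_gamma1_qExpansion_coeff_eq_mul` (Shimura 1971 Prop. 3.64) produces the form but HIDES its
function; this file re-runs its three-line construction with the function EXPOSED:
* §1 `exists_modularForm_translateSum_coe_eq` (any period `Q`, weights `b : ZMod Q → ℂ`: `Σ_j b j · F(· + j/Q)` on `Γ₁(L Q²)`, function AND
  q-expansion exposed) and `exists_modularForm_twist_coe_eq` — for `F₀ : ModularForm (Gamma1 L) k` and ANY weights `h : ZMod (q^2) → ℂ` there is
  `V : ModularForm (Gamma1 (L * (q^2)^2)) k` with `⇑V =` T3's `hV` right-hand side AND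
  `coeff n (qExpansion 1 V) = ĥ(n) · coeff n (qExpansion 1 F₀)`, `ĥ(n) = ((q:ℂ)^2)⁻¹ * Σ_j h j * ψ_{q²}(j·n)` (`ψ = ZMod.stdAddChar`; for the
  Legendre weights `h = h_σ` seat w6 g9's cut identity `sum_legendreClassWeight_mul_stdAddChar_sq` turns `ĥ` into the indicator of
  `{q ∥ n, J(n/q | q) = σ}`);
* §2 `forall_coeff_twist_mem` — the `hcoef` FEEDER in NF-Q currency: if `coeff n (qExpansion 1 V) = ĥ(n)·c₀(n)` with `ĥ(n) ∈ ℤ̄[1/N]` and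
  `c₀(n) ∈ p·ℤ̄[1/N]` wherever `ĥ(n) ≠ 0`, then every coefficient of `qExpansion 1 V` lies in `p·ℤ̄[1/N]`.
No new definitions, no named facts, no `sorry`. beyond-print theorem: NO. BSD is not proved by any of this; no summit statement is proved by this seat.

References: [Shimura1971] Prop. 3.64; [KoblitzECMF1993] III §3 Prop. 17; [Katz1973] §1.6 (the consumer); crux notes lead-g14 §2.1.
-/

-- summit-side namespace `Summit.BirchSwinnertonDyer.BirchSwinnertonDyer.…` (single-conjunct summit, D-0017 layout)
set_option linter.dupNamespace false

noncomputable section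

namespace Summit.BirchSwinnertonDyer.BirchSwinnertonDyer.Theorems.PrintCFram.FlipRung

open UpperHalfPlane Filter Function Complex CongruenceSubgroup PowerSeries
open scoped MatrixGroups ModularForm Topology Manifold Real
open Matrix.GeneralLinearGroup ConjAct Pointwise
open Literature.NumberTheory.ModularForms
open Literature.NumberTheory.EllipticCurves.ModularForms (slash_upperRightHom_apply qParam_vadd)
open Literature.NumberTheory.EllipticCurves.ModularForms.HeckeTGamma1 (one_mem_strictPeriods_Gamma1)

/-! ## §1 The twisted vehicle as a modular form on `Γ₁(L q⁴)`, function exposed -/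

/-- `e^{2πi (j/Q) m} = ψ_Q(j·m)` for the standard additive character `ψ_Q` of `ℤ/Qℤ` (Mathlib `ZMod.stdAddChar`; the Literature file
`ModularFormPeriodicTwist` has this as a private lemma). [folklore] -/
theorem cexp_val_div_mul_eq_stdAddChar {Q : ℕ} [NeZero Q] (j : ZMod Q) (m : ℕ) :
    cexp (2 * π * Complex.I * ((j.val : ℝ) / Q : ℝ) * m) = ZMod.stdAddChar (j * (m : ZMod Q)) := by
  have : j * (m : ZMod Q) = (((j.val * m : ℕ) : ℤ) : ZMod Q) := by
    push_cast
    rw [ZMod.natCast_zmod_val]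
  rw [this, ZMod.stdAddChar_coe]
  push_cast
  ring_nf

/-- **TRANSLATE SUMS ARE MODULAR FORMS ON `Γ₁(L Q²)` (function exposed).** For `F : ModularForm (Gamma1 L) k`, `Q ≥ 1` and ANY weights
`b : ℤ/Q → ℂ`, the function `z ↦ Σ_{j mod Q} b(j) F(z + j/Q)` is (the function of) a modular form of weight `k` on `Γ₁(L Q²)`, with q-expansion
`coeff n = (Σ_j b(j) ψ_Q(j n)) · coeff n (qExpansion 1 F)` (Shimura 1971 Prop. 3.64: each translate `F ∣_k [1, j/Q; 0, 1]` is a form on `Γ₁(L Q²)`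
with q-expansion `Σ e^{2πi n j/Q} c(n) qⁿ`; the Literature theorem `PeriodicTwist.exists_modularForm_qExpansion_coeff_eq_mul` is this with the function
hidden). Serves T3's twisted vehicle (`Q = q²`, below) and (G)'s away-from-`q` cut (`Q = Q₀`). [cite: Shimura1971, Prop. 3.64] -/
theorem exists_modularForm_translateSum_coe_eq {L : ℕ} [NeZero L] {k : ℤ} (F : ModularForm (Gamma1 L) k) (Q : ℕ) [NeZero Q]
    (b : ZMod Q → ℂ) :
    ∃ g : ModularForm (Gamma1 (L * Q ^ 2)) k,
      (∀ z : ℍ, g z = ∑ j : ZMod Q, b j * F (((j.val : ℝ) / (Q : ℝ)) +ᵥ z)) ∧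
      ∀ n : ℕ, (qExpansion 1 ⇑g).coeff n = (∑ j : ZMod Q, b j * ZMod.stdAddChar (j * (n : ZMod Q))) * (qExpansion 1 ⇑F).coeff n := by
  choose g hg using fun j : ZMod Q ↦
    PeriodicTwist.exists_modularForm_coe_eq_slash_upperRightHom F ((j.val : ℝ) / (Q : ℝ))
      (PeriodicTwist.gamma1_mul_sq_le_conj_upperRightHom L Q j.val)
  have hcoe : (⇑(∑ j : ZMod Q, b j • g j) : ℍ → ℂ) = ∑ j : ZMod Q, b j • (⇑(g j) : ℍ → ℂ) :=
    map_sum (ModularForm.coeHom (Γ := Gamma1 (L * Q ^ 2)) (k := k)) _ Finset.univ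
  refine ⟨∑ j : ZMod Q, b j • g j, ?_, ?_⟩
  · intro z
    rw [hcoe, Finset.sum_apply]
    refine Finset.sum_congr rfl fun j _ ↦ ?_
    rw [Pi.smul_apply, smul_eq_mul, hg j, slash_upperRightHom_apply]
  · intro n
    have hΓ' := one_mem_strictPeriods_Gamma1 (L * Q ^ 2)
    have hsum : ∀ τ : ℍ, HasSum (fun m : ℕ ↦
        ((∑ j : ZMod Q, b j * ZMod.stdAddChar (j * (m : ZMod Q))) * (qExpansion 1 ⇑F).coeff m) •
          Periodic.qParam 1 (τ : ℂ) ^ m) ((∑ j : ZMod Q, b j • g j) τ) := by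
      intro τ
      have hj : ∀ j ∈ (Finset.univ : Finset (ZMod Q)), HasSum (fun m : ℕ ↦ b j *
          ((ZMod.stdAddChar (j * (m : ZMod Q)) * (qExpansion 1 ⇑F).coeff m) • Periodic.qParam 1 (τ : ℂ) ^ m))
          (b j * g j τ) := by
        intro j _
        have h1 := PeriodicTwist.hasSum_slash_upperRightHom (one_mem_strictPeriods_Gamma1 L) F ((j.val : ℝ) / (Q : ℝ)) τ
        simp only [cexp_val_div_mul_eq_stdAddChar] at h1
        have h2 := h1.mul_left (b j)
        rwa [← hg j] at h2
      have hs := hasSum_sum hj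
      rw [hcoe, Finset.sum_apply]
      convert hs using 1
      · funext m
        simp only [smul_eq_mul]
        rw [Finset.sum_mul, Finset.sum_mul]
        exact Finset.sum_congr rfl fun j _ ↦ by ring
      · exact Finset.sum_congr rfl fun j _ ↦ by simp [Pi.smul_apply, smul_eq_mul]
    exact (ModularFormClass.qExpansion_coeff_unique one_pos hΓ' hsum n).symm

/-- **THE TWISTED VEHICLE IS A MODULAR FORM ON `Γ₁(L q⁴)` (function exposed).** For `F₀ : ModularForm (Gamma1 L) k`, `q ≥ 1` and ANY
weights `h : ℤ/q² → ℂ`, the function `V(z) = q⁻² Σ_{j mod q²} h(j) F₀(z + j/q²)` (T3's `hV`, verbatim) is (the function of) a modular form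
of weight `k` on `Γ₁(L (q²)²)`, and `coeff n (qExpansion 1 V) = ĥ(n) · coeff n (qExpansion 1 F₀)` with `ĥ(n) = q⁻² Σ_j h(j) ψ_{q²}(j n)`.
[cite: Shimura1971, Prop. 3.64] -/
theorem exists_modularForm_twist_coe_eq {L : ℕ} [NeZero L] {k : ℤ} (F₀ : ModularForm (Gamma1 L) k) (q : ℕ) [NeZero (q ^ 2)]
    (h : ZMod (q ^ 2) → ℂ) :
    ∃ V : ModularForm (Gamma1 (L * (q ^ 2) ^ 2)) k,
      (∀ z : ℍ, V z = ((q : ℂ) ^ 2)⁻¹ * ∑ j : ZMod (q ^ 2), h j * F₀ (((j.val : ℝ) / (q : ℝ) ^ 2) +ᵥ z)) ∧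
      ∀ n : ℕ, (qExpansion 1 ⇑V).coeff n =
        (((q : ℂ) ^ 2)⁻¹ * ∑ j : ZMod (q ^ 2), h j * ZMod.stdAddChar (j * (n : ZMod (q ^ 2)))) * (qExpansion 1 ⇑F₀).coeff n := by
  have hq2R : (((q ^ 2 : ℕ) : ℝ)) = (q : ℝ) ^ 2 := by push_cast; ring
  obtain ⟨V, hV, hc⟩ := exists_modularForm_translateSum_coe_eq F₀ (q ^ 2) fun j ↦ ((q : ℂ) ^ 2)⁻¹ * h j
  refine ⟨V, fun z ↦ ?_, fun n ↦ ?_⟩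
  · rw [hV z, Finset.mul_sum]
    exact Finset.sum_congr rfl fun j _ ↦ by rw [hq2R, mul_assoc]
  · rw [hc n, Finset.mul_sum]
    exact congrArg (· * _) (Finset.sum_congr rfl fun j _ ↦ by rw [mul_assoc])

/-! ## §2 The `hcoef` feeder in NF-Q currency -/

/-- **The coefficients of the twisted vehicle lie in `p·ℤ̄[1/N]`** as soon as its q-expansion factors as `ĥ(n)·c₀(n)` with `ĥ(n) ∈ ℤ̄[1/N]`
and `c₀(n) ∈ p·ℤ̄[1/N]` wherever `ĥ(n) ≠ 0` (so only the indices ON the cut matter — «cut form ≡ 0 (mod p)»): the hypothesis `hcoef` of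
`FlipRung.exists_isIntegral_qExpansion_slash_coeff` / `norm_ratCast_le_inv_of_coeff_eq_unit_mul`. [folklore] -/
theorem forall_coeff_twist_mem {N p : ℕ} {A : PowerSeries ℂ} {hh c₀ : ℕ → ℂ} (hA : ∀ n : ℕ, coeff n A = hh n * c₀ n)
    (hhh : ∀ n : ℕ, ∃ j : ℕ, IsIntegral ℤ ((N : ℂ) ^ j * hh n))
    (hc₀ : ∀ n : ℕ, hh n ≠ 0 → ∃ y : ℂ, (∃ j : ℕ, IsIntegral ℤ ((N : ℂ) ^ j * y)) ∧ c₀ n = (p : ℂ) * y) :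
    ∀ n : ℕ, ∃ y : ℂ, (∃ j : ℕ, IsIntegral ℤ ((N : ℂ) ^ j * y)) ∧ coeff n A = (p : ℂ) * y := by
  intro n
  rw [hA n]
  by_cases h0 : hh n = 0
  · exact ⟨0, exists_isIntegral_pow_mul_zero, by rw [h0]; simp⟩
  · exact exists_eq_natCast_mul_mul_left (hhh n) (hc₀ n h0)

/-- The INDICATOR case of §2: if `coeff n A = (if P n then c₀ n else 0)` and `c₀(n) ∈ p·ℤ̄[1/N]` whenever `P n`, then every coefficient
of `A` lies in `p·ℤ̄[1/N]` (the Legendre-class cut: `ĥ = 𝟙_{q ∥ n, J(n/q|q) = σ}` by w6 g9's `sum_legendreClassWeight_mul_stdAddChar_sq`). [folklore] -/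
theorem forall_coeff_ite_mem {N p : ℕ} {A : PowerSeries ℂ} {P : ℕ → Prop} [DecidablePred P] {c₀ : ℕ → ℂ}
    (hA : ∀ n : ℕ, coeff n A = if P n then c₀ n else 0)
    (hc₀ : ∀ n : ℕ, P n → ∃ y : ℂ, (∃ j : ℕ, IsIntegral ℤ ((N : ℂ) ^ j * y)) ∧ c₀ n = (p : ℂ) * y) :
    ∀ n : ℕ, ∃ y : ℂ, (∃ j : ℕ, IsIntegral ℤ ((N : ℂ) ^ j * y)) ∧ coeff n A = (p : ℂ) * y := by
  intro n
  rw [hA n]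
  by_cases hP : P n
  · rw [if_pos hP]; exact hc₀ n hP
  · rw [if_neg hP]; exact ⟨0, exists_isIntegral_pow_mul_zero, by simp⟩

end Summit.BirchSwinnertonDyer.BirchSwinnertonDyer.Theorems.PrintCFram.FlipRung

end
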